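import Summits.CriticalPhenomena.PercolationContinuityZ3.Theorems.PercNearOneGluingNoHeavyLowerTailSunflowerPurePayer
import HarnessLib

/-!
# `NoHeavyLowerTail` (crux stmt-CriticalPhenomena-4575), abstract sunflower cubic: the FLIPPED (mixed-fibre) partition functionals —
# `ZHflip D = 3(SAflip D + SBflip D) − Ntriflip D` with BOTH flipped spectator surpluses `≥ 0` (PROVED, polarised antipodal Gladkov),
# and the typed dichotomy `FlipPurePayer` ("prove-1's `PurePayer` on every mixed fibre"), which implies `ZHflip D ≥ 0` for all `D`
# (prim-l12-p2's Conjecture G for three petals) and `PurePayer` (`D = ∅`)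

Support file (seat `prim-ineq-gen-2` gen 29; `--supports stmt-CriticalPhenomena-4575`).  Nothing is asserted about the crux; no `sorry`, no named
facts, standard axioms; the `@[conjecture]` definition is an obligation of the programme, never a fact.
Memo: run/shared/lean/prim/prim-ineq-gen-2/SHARP-FORM-GEN29.md §7.

SETTING (`SunflowerPartition.Sunflower`, prove-1 g25–g29: `parts`, `kk`, `s6H`, `triP`, `Sw`, `SA`, `SB`, `Ntri`, `ZH = 3(SA + SB) − Ntri`,
`PurePayer : Ntri ≤ 3·max(SA, SB)`).  The MIXED FIBRES of the law-level cubic (three independent samples of a product measure, conditioned on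
the number `k_x ∈ {1,2}` of samples containing each coordinate `x`) are, as prim-l12-p2 observed (`MSunflower.ZKflip`, Conjecture G), the
ordered 3-partitions `(P¹,P²,P³)` with every block replaced by its symmetric difference with the fixed set `D = {x : k_x = 2}`.

THIS FILE [this work]:
* `Sunflower.Swflip D w := Σ_{(P¹,P²,P³)} w(lab(P¹ △ D)) · kk(lab(P² △ D), lab(P³ △ D))`, `SAflip`, `SBflip`, `Ntriflip`, `ZHflip`
  (`ZHflip ∅ = ZH`, `Swflip ∅ w = Sw w`).
* **`Swflip_nonneg`** (THEOREM): `w ≥ 0 ⟹ Swflip D w ≥ 0`.  Proof: fix the spectator block `S = P¹`; with `G := D ∩ S` and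
  `E := Sᶜ ∩ D` one has `P² △ D = G ∪ (P² △ E)` and `P³ △ D = G ∪ (Sᶜ ∖ (P² △ E))`, and `T ↦ T △ E` permutes the subsets of `Sᶜ`; so the
  inner sum is prove-1's POLARISED antipodal Gladkov sum `Σ_{Z ⊆ Sᶜ} kk(lab(G ∪ Z), lab(G ∪ (Sᶜ ∖ Z))) ≥ 0` (`antipodal_gladkov_polarized`).
  Hence `SAflip, SBflip ≥ 0` — the fibrewise Gladkov halves of the memo's ladder.
* `ZHflip_eq_SAflip_SBflip : ZHflip D = 3(SAflip D + SBflip D) − Ntriflip D` (spectator form, as `ZH_eq_SA_SB`).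
* `FlipPurePayer` (typed CONJECTURE): `Ntriflip D ≤ 3·max(SAflip D, SBflip D)` for every finite three-petal sunflower and every `D` — on each
  mixed fibre ONE of the two Gladkov slacks alone pays for the rainbow assignments.  Census (memo §7, kit j198690/92/93, j198753/54/55 +
  exhaustive n ≤ 4): 0 failures among ≈ 8.6·10⁶ fibres on ≤ 8 points (both slacks fail separately on mixed fibres).  `D = ∅` is `PurePayer`
  (`purePayer_of_flipPurePayer`); `ZHflip_nonneg_of_flipPurePayer`: it implies `0 ≤ ZHflip D` for all `D` (Conjecture G, three petals), in
  particular `PartitionLemmaH` (`partitionLemmaH_of_flipPurePayer`).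
-/

namespace Summit.CriticalPhenomena.PercolationContinuityZ3.Theorems.SunflowerPartition

open Finset

variable {α : Type*} [Fintype α] [DecidableEq α]

/-! ## Set algebra of the flip on one fibre -/

omit [Fintype α] in
/-- `(T △ E) △ E = T`. [folklore] -/
theorem symmDiff_symmDiff_cancel (T E : Finset α) : symmDiff (symmDiff T E) E = T :=
  symmDiff_symmDiff_cancel_right E T

/-- For `T ⊆ Sᶜ`: `T △ D = (D ∩ S) ∪ (T △ (Sᶜ ∩ D))`. [this work] -/
theorem symmDiff_eq_core_union {S T : Finset α} (D : Finset α) (hT : T ⊆ Sᶜ) :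
    symmDiff T D = (D ∩ S) ∪ symmDiff T (Sᶜ ∩ D) := by
  ext x
  simp only [mem_symmDiff, mem_union, mem_inter, mem_compl]
  have hx : x ∈ T → x ∉ S := fun h => by simpa [mem_compl] using hT h
  tauto

/-- For `T ⊆ Sᶜ`: `(S ∪ T)ᶜ △ D = (D ∩ S) ∪ (Sᶜ ∖ (T △ (Sᶜ ∩ D)))`. [this work] -/
theorem compl_union_symmDiff_eq {S T : Finset α} (D : Finset α) (hT : T ⊆ Sᶜ) :
    symmDiff (S ∪ T)ᶜ D = (D ∩ S) ∪ (Sᶜ \ symmDiff T (Sᶜ ∩ D)) := by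
  ext x
  simp only [mem_symmDiff, mem_union, mem_inter, mem_compl, mem_sdiff]
  have hx : x ∈ T → x ∉ S := fun h => by simpa [mem_compl] using hT h
  tauto

/-- `T ⊆ Sᶜ ⟹ T △ (Sᶜ ∩ D) ⊆ Sᶜ`. [this work] -/
theorem symmDiff_subset_compl {S T : Finset α} (D : Finset α) (hT : T ⊆ Sᶜ) : symmDiff T (Sᶜ ∩ D) ⊆ Sᶜ := by
  intro x hx
  rw [mem_symmDiff] at hx
  rcases hx with ⟨h, -⟩ | ⟨h, -⟩
  · exact hT h
  · exact (mem_inter.1 h).1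

namespace Sunflower

variable (F : Sunflower α) (D : Finset α)

/-! ## Flipped spectator sums -/

/-- The FLIPPED spectator sum: `Σ_{(P¹,P²,P³)} w(lab(P¹ △ D)) · kk(lab(P² △ D), lab(P³ △ D))`. [this work] -/
def Swflip (w : Fin 5 → ℤ) : ℤ :=
  ∑ q ∈ parts α, w (F.lab (symmDiff q.1 D)) * kk (F.lab (symmDiff q.2 D)) (F.lab (symmDiff (q.1 ∪ q.2)ᶜ D))

/-- `Swflip ∅ = Sw`. [this work] -/
theorem Swflip_empty (w : Fin 5 → ℤ) : F.Swflip ∅ w = F.Sw w := by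
  unfold Swflip Sw
  have h : ∀ s : Finset α, symmDiff s ∅ = s := fun s => symmDiff_bot s
  simp only [h]

/-- **Flipped spectator sums with nonnegative weights are nonnegative** (polarised antipodal Gladkov on the complement of the spectator
block, after the flip involution `T ↦ T △ (Sᶜ ∩ D)`). [this work] -/
theorem Swflip_nonneg (w : Fin 5 → ℤ) (hw : ∀ v, 0 ≤ w v) : 0 ≤ F.Swflip D w := by
  unfold Swflip
  rw [sum_parts_eq (f := fun S T => w (F.lab (symmDiff S D)) * kk (F.lab (symmDiff T D)) (F.lab (symmDiff (S ∪ T)ᶜ D)))]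
  refine sum_nonneg fun S _ => ?_
  rw [← mul_sum]
  refine mul_nonneg (hw _) ?_
  set G : Finset α := D ∩ S with hG
  set E : Finset α := Sᶜ ∩ D with hE
  have key : ∑ T ∈ (Sᶜ).powerset, kk (F.lab (symmDiff T D)) (F.lab (symmDiff (S ∪ T)ᶜ D)) =
      ∑ Z ∈ (Sᶜ).powerset, kk (F.lab (G ∪ Z)) (F.lab (G ∪ (Sᶜ \ Z))) := by
    refine sum_nbij' (fun T => symmDiff T E) (fun Z => symmDiff Z E) ?_ ?_ ?_ ?_ ?_
    · intro T hT
      rw [mem_powerset] at hT ⊢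
      exact symmDiff_subset_compl D hT
    · intro Z hZ
      rw [mem_powerset] at hZ ⊢
      exact symmDiff_subset_compl D hZ
    · intro T _
      exact symmDiff_symmDiff_cancel T E
    · intro Z _
      exact symmDiff_symmDiff_cancel Z E
    · intro T hT
      rw [mem_powerset] at hT
      rw [symmDiff_eq_core_union D hT, compl_union_symmDiff_eq D hT]
  rw [key]
  exact F.antipodal_gladkov_polarized Sᶜ G G subset_rfl

/-- Flipped KERNEL-spectator surplus. [this work] -/
def SAflip : ℤ := F.Swflip D (fun v => if v = 4 then 1 else 0)

/-- Flipped BOTTOM-spectator surplus. [this work] -/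
def SBflip : ℤ := F.Swflip D (fun v => if v = 0 then 1 else 0)

/-- `SAflip ≥ 0` — the fibrewise Gladkov half `Z_aAG ≥ 0` of the memo. [this work] -/
theorem SAflip_nonneg : 0 ≤ F.SAflip D :=
  F.Swflip_nonneg D _ fun v => by split_ifs <;> decide

/-- `SBflip ≥ 0` — the fibrewise Gladkov half `Z_bAG ≥ 0`. [this work] -/
theorem SBflip_nonneg : 0 ≤ F.SBflip D :=
  F.Swflip_nonneg D _ fun v => by split_ifs <;> decide

/-- `Swflip` is additive in the weight. [this work] -/
theorem Swflip_add (w₁ w₂ : Fin 5 → ℤ) : F.Swflip D (fun v => w₁ v + w₂ v) = F.Swflip D w₁ + F.Swflip D w₂ := by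
  unfold Swflip
  rw [← sum_add_distrib]
  exact sum_congr rfl fun q _ => by ring

/-! ## The flipped partition functional and its spectator form -/

/-- The FLIPPED rainbow count `Σ triP(lab(P¹△D), lab(P²△D), lab(P³△D))`. [this work] -/
def Ntriflip : ℤ := ∑ q ∈ parts α, triP (F.lab (symmDiff q.1 D)) (F.lab (symmDiff q.2 D)) (F.lab (symmDiff (q.1 ∪ q.2)ᶜ D))

/-- The FLIPPED partition functional of the `H`-row: `Σ s6H(lab(P¹△D), lab(P²△D), lab(P³△D))` (prim-l12-p2's `ZKflip` for three petals). [this work] -/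
def ZHflip : ℤ := ∑ q ∈ parts α, s6H (F.lab (symmDiff q.1 D)) (F.lab (symmDiff q.2 D)) (F.lab (symmDiff (q.1 ∪ q.2)ᶜ D))

/-- `ZHflip ∅ = ZH`. [this work] -/
theorem ZHflip_empty : F.ZHflip ∅ = F.ZH := by
  unfold ZHflip ZH
  have h : ∀ s : Finset α, symmDiff s ∅ = s := fun s => symmDiff_bot s
  simp only [h]

/-- `Ntriflip ∅ = Ntri`. [this work] -/
theorem Ntriflip_empty : F.Ntriflip ∅ = F.Ntri := by
  unfold Ntriflip Ntri
  have h : ∀ s : Finset α, symmDiff s ∅ = s := fun s => symmDiff_bot s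
  simp only [h]

/-- `Ntriflip ≥ 0`. [this work] -/
theorem Ntriflip_nonneg : 0 ≤ F.Ntriflip D := by
  unfold Ntriflip
  exact sum_nonneg fun q _ => triP_nonneg _ _ _

/-- The symmetrised flipped spectator kernel sums to `3 · Swflip` (block-relabelling symmetry commutes with the flip). [this work] -/
theorem sum_spec_flip_eq (w : Fin 5 → ℤ) :
    ∑ q ∈ parts α, (w (F.lab (symmDiff q.1 D)) * kk (F.lab (symmDiff q.2 D)) (F.lab (symmDiff (q.1 ∪ q.2)ᶜ D)) +
        w (F.lab (symmDiff q.2 D)) * kk (F.lab (symmDiff q.1 D)) (F.lab (symmDiff (q.1 ∪ q.2)ᶜ D)) +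
        w (F.lab (symmDiff (q.1 ∪ q.2)ᶜ D)) * kk (F.lab (symmDiff q.1 D)) (F.lab (symmDiff q.2 D))) = 3 * F.Swflip D w := by
  rw [sum_add_distrib, sum_add_distrib]
  have h2 : ∑ q ∈ parts α, w (F.lab (symmDiff q.2 D)) * kk (F.lab (symmDiff q.1 D)) (F.lab (symmDiff (q.1 ∪ q.2)ᶜ D)) =
      F.Swflip D w := by
    unfold Swflip
    exact sum_parts_swap12 (fun A B C => w (F.lab (symmDiff B D)) * kk (F.lab (symmDiff A D)) (F.lab (symmDiff C D)))
  have h3 : ∑ q ∈ parts α, w (F.lab (symmDiff (q.1 ∪ q.2)ᶜ D)) * kk (F.lab (symmDiff q.1 D)) (F.lab (symmDiff q.2 D)) =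
      F.Swflip D w := by
    rw [show (∑ q ∈ parts α, w (F.lab (symmDiff (q.1 ∪ q.2)ᶜ D)) * kk (F.lab (symmDiff q.1 D)) (F.lab (symmDiff q.2 D))) =
        ∑ q ∈ parts α, w (F.lab (symmDiff q.1 D)) * kk (F.lab (symmDiff (q.1 ∪ q.2)ᶜ D)) (F.lab (symmDiff q.2 D)) from
      sum_parts_swap13 (fun A B C => w (F.lab (symmDiff C D)) * kk (F.lab (symmDiff A D)) (F.lab (symmDiff B D)))]
    unfold Swflip
    exact sum_congr rfl fun q _ => by rw [kk_comm]
  rw [h2, h3]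
  unfold Swflip
  ring

/-- **`ZHflip` in spectator form**: `ZHflip D = 3·Swflip D 1_{0,4} − Ntriflip D`. [this work] -/
theorem ZHflip_eq_spec : F.ZHflip D = 3 * F.Swflip D (fun v => if v = 0 ∨ v = 4 then 1 else 0) - F.Ntriflip D := by
  rw [← F.sum_spec_flip_eq D]
  unfold ZHflip Ntriflip
  rw [← sum_sub_distrib]
  exact sum_congr rfl fun q _ => s6H_eq_spec _ _ _

/-- **`ZHflip D = 3·(SAflip D + SBflip D) − Ntriflip D`**. [this work] -/
theorem ZHflip_eq_SAflip_SBflip : F.ZHflip D = 3 * (F.SAflip D + F.SBflip D) - F.Ntriflip D := by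
  rw [F.ZHflip_eq_spec D]
  unfold SAflip SBflip
  rw [← F.Swflip_add D]
  congr 3
  funext v
  revert v
  decide

/-- `SAflip ∅ = SA`, `SBflip ∅ = SB`. [this work] -/
theorem SAflip_empty : F.SAflip ∅ = F.SA ∧ F.SBflip ∅ = F.SB := by
  unfold SAflip SBflip SA SB
  exact ⟨F.Swflip_empty _, F.Swflip_empty _⟩

end Sunflower

/-! ## The mixed-fibre pure-payer dichotomy -/

/-- **CONJECTURE `FlipPurePayer`** (this work; OPEN; memo SHARP-FORM-GEN29 §7): for every finite three-petal sunflower of up-sets `F` and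
EVERY subset `D` of the ground set, on the `D`-flipped fibre the LARGER of the two spectator surpluses alone pays for the rainbow
assignments: `Ntriflip D ≤ 3·max(SAflip D, SBflip D)`.  `D = ∅` is prim-ineq-prove-1's `PurePayer` (`purePayer_of_flipPurePayer`); the
conjecture implies `0 ≤ ZHflip D` for all `D` (prim-l12-p2's Conjecture G for three petals, `ZHflip_nonneg_of_flipPurePayer`).  Census: 0
failures among all 2 336 fibres on ≤ 4 points and ≈ 8.6·10⁶ sampled fibres on 5–8 points (both surpluses fail separately on mixed fibres).
Its law-level shadow is (C1-law) `max(a,b)·(ab − e₂) ≥ e₃`; its one-coordinate shadow is `LawPencil.LawPolarizedC1`.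
An obligation, never a fact: use as `(h : FlipPurePayer)`. [status: open] -/
@[conjecture] def FlipPurePayer : Prop :=
  ∀ (α : Type) [Fintype α] [DecidableEq α] (F : Sunflower α) (D : Finset α), F.Ntriflip D ≤ 3 * max (F.SAflip D) (F.SBflip D)

/-- **`FlipPurePayer ⟹ 0 ≤ ZHflip D`** for every `D` (Conjecture G for three petals): `ZHflip = 3(SAflip + SBflip) − Ntriflip ≥
3·max − Ntriflip ≥ 0` since both surpluses are nonnegative. [this work] -/
theorem ZHflip_nonneg_of_flipPurePayer (h : FlipPurePayer) {α : Type} [Fintype α] [DecidableEq α] (F : Sunflower α)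
    (D : Finset α) : 0 ≤ F.ZHflip D := by
  have hP := h α F D
  have hA := F.SAflip_nonneg D
  have hB := F.SBflip_nonneg D
  rw [F.ZHflip_eq_SAflip_SBflip D]
  rcases le_total (F.SAflip D) (F.SBflip D) with hle | hle
  · rw [max_eq_right hle] at hP
    linarith
  · rw [max_eq_left hle] at hP
    linarith

/-- **`FlipPurePayer ⟹ PurePayer`** (`D = ∅`). [this work] -/
theorem purePayer_of_flipPurePayer (h : FlipPurePayer) : PurePayer := by
  intro α _ _ F
  have hP := h α F ∅
  rw [F.Ntriflip_empty, (F.SAflip_empty).1, (F.SAflip_empty).2] at hP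
  exact hP

/-- **`FlipPurePayer ⟹ PartitionLemmaH`** (★). [this work] -/
theorem partitionLemmaH_of_flipPurePayer (h : FlipPurePayer) : PartitionLemmaH :=
  partitionLemmaH_of_purePayer (purePayer_of_flipPurePayer h)

end Summit.CriticalPhenomena.PercolationContinuityZ3.Theorems.SunflowerPartition
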